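import Literature.NumberTheory.Automorphic.ReciprocityGLn
import Literature.NumberTheory.Automorphic.ReciprocityGLnPatchingGalois
import Literature.NumberTheory.GaloisRepresentations.ResidualPairIntegrality

/-!
# Level-one dyadic companions, part 8c: the a.e.-COMPANION CLAUSE is compatibility with ONE Frobenius datum
# (census instrument I-g12.1 of the lens-4 g12 node `QuadraticPatchingNormalForm`, answered by a kernel-checked bridge)

decomp-langlands census-1 g15.  The pieces QC = `QuadraticLayerCompanions` / QD = `QuadraticPatchingDescent` of part 8
(`Theorems/LevelOneDyadicQuadratic.lean`) phrase «ρ₂ is a 2-adic companion of ρ through (ι, ι₂) at w» as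
`∃ α : Multiset ℂ, ρ.HasFrobCharpolyAt w (arithFrobPolyOfSatake ι q 1 α) ∧ ρ₂.HasFrobCharpolyAt w (arithFrobPolyOfSatake ι₂ q 1 α)`.
QD's engine (Sorensen patching, `Literature.NumberTheory.Automorphic.ReciprocityGLnPatchingGalois`) is stated for
`PatchingFamily.CompatibleAE E ρ₂` / read-off polynomials `((E v).map fun a ↦ X - C a).prod` of ONE datum `E` of Frobenius
eigenvalues.  The lens asked (I-g12.1, «the cheapest falsifier») whether the two agree.  They do, place by place and hence almost
everywhere: with `m = 1` the predicted polynomial is `∏_{a ∈ α} (X - ι⁻¹(a⁻¹))` (`arithFrobPolyOfSatake_one`), the Frobenius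
polynomial of `ρ` at `w` is unique (`FramedGaloisRep.HasFrobCharpolyAt.unique`), so `α` is forced to be `(roots of ρ at w).map (ι ·)⁻¹`
and the clause says exactly that `ρ₂` has Frobenius polynomial `∏_{r} (X - θ r)` with `θ = ι₂⁻¹ ∘ ι` — the read-off polynomial
`PatchingFamily.frobPoly E w 1` of the datum `E w = (roots of ρ at w).map θ` (`companionClauseAt_iff`, `companionClause_eventually_iff`,
`frobDatumPoly_eq_frobPoly_one`).  For an a.e.-unramified `ρ` such a root datum exists at almost every place
(`exists_eventually_hasFrobCharpolyAt_rootDatum`: `ℚ̄_ℓ` is algebraically closed and Frobenius polynomials are monic of degree `n`).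
Consequence for QD's plumbing (node § Engine step (0)): no restatement of the companion clause is needed.
0 sorry; axioms standard; no definitions.  Sources: Serre, *Abelian ℓ-adic representations* I §2.1 (uniqueness of `P_{v,ρ}`);
Buzzard–Gee 2014 §2.1 (the `m = 1` normalisation); the part-8 module docstring.
-/

set_option linter.dupNamespace false

namespace Summit.Langlands.Langlands.Theorems.LevelOneDyadic.Quadratic

open Polynomial Filter IsDedekindDomain
open scoped NumberField
open Literature.NumberTheory.GaloisRepresentations Literature.NumberTheory.Automorphic

variable {K : Type} [Field K] [NumberField K] {ℓ : ℕ} [Fact ℓ.Prime] {n : ℕ}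

/-- A product of linear factors indexed through a function `f` is the `X - C`-product over the mapped multiset. [folklore] -/
theorem prod_X_sub_C_map {R S : Type*} [CommRing R] (s : Multiset S) (f : S → R) :
    (s.map fun a ↦ X - C (f a)).prod = ((s.map f).map fun b ↦ X - C b).prod := by
  rw [Multiset.map_map]; rfl

/-- With `m = 1`, choosing `α = (ι r)⁻¹` over a root multiset `A ⊂ ℚ̄_ℓ` makes the predicted polynomial on the `ℓ`-adic side
`∏_{r ∈ A} (X - r)` (`ι⁻¹(((ι r)⁻¹)⁻¹) = r`). [folklore] -/
theorem arithFrobPolyOfSatake_one_map_inv (ι : PadicAlgCl ℓ ≃+* ℂ) (q : ℕ) (A : Multiset (PadicAlgCl ℓ)) :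
    arithFrobPolyOfSatake ι q 1 (A.map fun r ↦ (ι r)⁻¹) = (A.map fun r ↦ X - C r).prod := by
  rw [arithFrobPolyOfSatake_one, Multiset.map_map]
  congr 1
  exact Multiset.map_congr rfl fun r _ ↦ by simp

/-- With `m = 1`, the same choice of `α` makes the predicted polynomial on the `2`-adic side `∏_{r ∈ A} (X - θ r)`,
`θ = ι₂⁻¹ ∘ ι`. [folklore] -/
theorem arithFrobPolyOfSatake_one_map_inv₂ (ι : PadicAlgCl ℓ ≃+* ℂ) (ι₂ : PadicAlgCl 2 ≃+* ℂ) (q : ℕ)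
    (A : Multiset (PadicAlgCl ℓ)) :
    arithFrobPolyOfSatake ι₂ q 1 (A.map fun r ↦ (ι r)⁻¹) = (A.map fun r ↦ X - C (ι₂.symm (ι r))).prod := by
  rw [arithFrobPolyOfSatake_one, Multiset.map_map]
  congr 1
  exact Multiset.map_congr rfl fun r _ ↦ by simp

/-- **The companion clause at one place is compatibility with the datum `θ(roots)`.**  If `ρ` has Frobenius polynomial
`∏_{r ∈ A} (X - r)` at `w` (e.g. `ρ` unramified at `w`, `A` = its Frobenius roots), then for every `ρ₂` and every `q`:
`(∃ α, ρ ~ arithFrobPolyOfSatake ι q 1 α ∧ ρ₂ ~ arithFrobPolyOfSatake ι₂ q 1 α at w) ↔ ρ₂ ~ ∏_{r ∈ A} (X - ι₂⁻¹(ι r)) at w`.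
Uniqueness of the Frobenius polynomial (Serre I §2.1) forces `α.map (ι⁻¹ ·⁻¹) = A`. [folklore] -/
theorem companionClauseAt_iff (ι : PadicAlgCl ℓ ≃+* ℂ) (ι₂ : PadicAlgCl 2 ≃+* ℂ)
    {ρ : FramedGaloisRep K (PadicAlgCl ℓ) n} {ρ₂ : FramedGaloisRep K (PadicAlgCl 2) n}
    {w : HeightOneSpectrum (𝓞 K)} (q : ℕ) {A : Multiset (PadicAlgCl ℓ)}
    (hA : ρ.HasFrobCharpolyAt w ((A.map fun r ↦ X - C r).prod)) :
    (∃ α : Multiset ℂ, ρ.HasFrobCharpolyAt w (arithFrobPolyOfSatake ι q 1 α) ∧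
        ρ₂.HasFrobCharpolyAt w (arithFrobPolyOfSatake ι₂ q 1 α)) ↔
      ρ₂.HasFrobCharpolyAt w ((A.map fun r ↦ X - C (ι₂.symm (ι r))).prod) := by
  constructor
  · rintro ⟨α, h₁, h₂⟩
    have e := h₁.unique hA
    rw [arithFrobPolyOfSatake_one, prod_X_sub_C_map] at e
    have hαA : α.map (fun a ↦ ι.symm a⁻¹) = A := by
      have := congrArg Polynomial.roots e
      rwa [Polynomial.roots_multiset_prod_X_sub_C, Polynomial.roots_multiset_prod_X_sub_C] at this
    rw [← hαA, Multiset.map_map]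
    rw [arithFrobPolyOfSatake_one] at h₂
    convert h₂ using 3 with a
    simp
  · intro h
    exact ⟨A.map fun r ↦ (ι r)⁻¹, by rwa [arithFrobPolyOfSatake_one_map_inv],
      by rwa [arithFrobPolyOfSatake_one_map_inv₂]⟩

/-- At an unramified place of a number field an `ℓ`-adic representation has a ROOT DATUM: a multiset `A ⊂ ℚ̄_ℓ` with Frobenius
polynomial `∏_{r ∈ A} (X - r)` (the polynomial is the characteristic polynomial of a matrix, monic, and `ℚ̄_ℓ` is algebraically
closed).  Serre I §2.1. [folklore] -/
theorem exists_hasFrobCharpolyAt_rootDatum {ρ : FramedGaloisRep K (PadicAlgCl ℓ) n} {w : HeightOneSpectrum (𝓞 K)}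
    (h : ρ.IsUnramifiedAt w) : ∃ A : Multiset (PadicAlgCl ℓ), ρ.HasFrobCharpolyAt w ((A.map fun r ↦ X - C r).prod) := by
  haveI : IsAlgClosed (PadicAlgCl ℓ) := AlgebraicClosure.isAlgClosed _
  obtain ⟨𝔓, h𝔓⟩ := w.primesAbove_nonempty
  obtain ⟨g, hg⟩ := HeightOneSpectrum.exists_isArithFrobAt_of_mem_primesAbove_holds h𝔓
  have hP := h.hasFrobCharpolyAt_charpoly h𝔓 hg
  have hmonic : (FramedRep.charpoly ρ g).Monic := Matrix.charpoly_monic _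
  refine ⟨(FramedRep.charpoly ρ g).roots, ?_⟩
  rwa [← (IsAlgClosed.splits (FramedRep.charpoly ρ g)).eq_prod_roots_of_monic hmonic]

/-- For an a.e.-unramified `ρ` there is a root datum `A` at almost every place. [folklore] -/
theorem exists_eventually_hasFrobCharpolyAt_rootDatum {ρ : FramedGaloisRep K (PadicAlgCl ℓ) n}
    (h : ∀ᶠ w : HeightOneSpectrum (𝓞 K) in cofinite, ρ.IsUnramifiedAt w) :
    ∃ A : HeightOneSpectrum (𝓞 K) → Multiset (PadicAlgCl ℓ),
      ∀ᶠ w : HeightOneSpectrum (𝓞 K) in cofinite, ρ.HasFrobCharpolyAt w (((A w).map fun r ↦ X - C r).prod) := by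
  classical
  refine ⟨fun w ↦ if hw : ρ.IsUnramifiedAt w then (exists_hasFrobCharpolyAt_rootDatum hw).choose else 0,
    h.mono fun w hw ↦ ?_⟩
  simp only [dif_pos hw]
  exact (exists_hasFrobCharpolyAt_rootDatum hw).choose_spec

/-- **The a.e.-companion clause is a.e. compatibility with the datum `θ(roots)`** (census instrument I-g12.1): given a root datum
`A` of `ρ` valid almost everywhere, for every `ρ₂` the a.e. clause of QC / QD (any place-dependent `q`, here `q w`) holds iff
`ρ₂` has Frobenius polynomial `∏_{r ∈ A w} (X - ι₂⁻¹(ι r))` at almost every `w`. [folklore] -/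
theorem companionClause_eventually_iff (ι : PadicAlgCl ℓ ≃+* ℂ) (ι₂ : PadicAlgCl 2 ≃+* ℂ)
    {ρ : FramedGaloisRep K (PadicAlgCl ℓ) n} (ρ₂ : FramedGaloisRep K (PadicAlgCl 2) n)
    (q : HeightOneSpectrum (𝓞 K) → ℕ) {A : HeightOneSpectrum (𝓞 K) → Multiset (PadicAlgCl ℓ)}
    (hA : ∀ᶠ w : HeightOneSpectrum (𝓞 K) in cofinite, ρ.HasFrobCharpolyAt w (((A w).map fun r ↦ X - C r).prod)) :
    (∀ᶠ w : HeightOneSpectrum (𝓞 K) in cofinite, ∃ α : Multiset ℂ,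
        ρ.HasFrobCharpolyAt w (arithFrobPolyOfSatake ι (q w) 1 α) ∧ ρ₂.HasFrobCharpolyAt w (arithFrobPolyOfSatake ι₂ (q w) 1 α)) ↔
      ∀ᶠ w : HeightOneSpectrum (𝓞 K) in cofinite, ρ₂.HasFrobCharpolyAt w (((A w).map fun r ↦ X - C (ι₂.symm (ι r))).prod) :=
  Filter.eventually_congr (hA.mono fun w hw ↦ companionClauseAt_iff ι ι₂ (q w) hw)

omit [NumberField K] in
/-- The read-off polynomial of the engine: `∏_{r ∈ A w} (X - θ r)` is `PatchingFamily.frobPoly E w 1` for the datum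
`E w = (A w).map θ`, `θ = ι₂⁻¹ ∘ ι` (`PatchingFamily.frobPoly_one`). [folklore] -/
theorem frobDatumPoly_eq_frobPoly_one (ι : PadicAlgCl ℓ ≃+* ℂ) (ι₂ : PadicAlgCl 2 ≃+* ℂ)
    (A : HeightOneSpectrum (𝓞 K) → Multiset (PadicAlgCl ℓ)) (w : HeightOneSpectrum (𝓞 K)) :
    ((A w).map fun r ↦ X - C (ι₂.symm (ι r))).prod =
      PatchingFamily.frobPoly (fun v ↦ (A v).map fun r ↦ ι₂.symm (ι r)) w 1 := by
  rw [PatchingFamily.frobPoly_one, prod_X_sub_C_map]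

/-- **I-g12.1, packaged.**  For an a.e.-unramified `ρ : Γ_K → GL_n(ℚ̄_ℓ)` there is ONE datum `E : places → Multiset ℚ̄₂` such that,
for every `ρ₂ : Γ_K → GL_n(ℚ̄₂)`, the a.e.-companion clause of QC / QD through (ι, ι₂) holds iff `ρ₂` has Frobenius polynomial
`PatchingFamily.frobPoly E w 1` at almost every place `w` — the unramified-compatibility relation Sorensen patching is stated for. [folklore] -/
theorem exists_frobDatum_companionClause_iff (ι : PadicAlgCl ℓ ≃+* ℂ) (ι₂ : PadicAlgCl 2 ≃+* ℂ)
    {ρ : FramedGaloisRep K (PadicAlgCl ℓ) n} (h : ∀ᶠ w : HeightOneSpectrum (𝓞 K) in cofinite, ρ.IsUnramifiedAt w) :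
    ∃ E : HeightOneSpectrum (𝓞 K) → Multiset (PadicAlgCl 2), ∀ ρ₂ : FramedGaloisRep K (PadicAlgCl 2) n,
      (∀ᶠ w : HeightOneSpectrum (𝓞 K) in cofinite, ∃ α : Multiset ℂ,
          ρ.HasFrobCharpolyAt w (arithFrobPolyOfSatake ι w.residueCard 1 α) ∧
            ρ₂.HasFrobCharpolyAt w (arithFrobPolyOfSatake ι₂ w.residueCard 1 α)) ↔
        ∀ᶠ w : HeightOneSpectrum (𝓞 K) in cofinite, ρ₂.HasFrobCharpolyAt w (PatchingFamily.frobPoly E w 1) := by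
  obtain ⟨A, hA⟩ := exists_eventually_hasFrobCharpolyAt_rootDatum h
  refine ⟨fun v ↦ (A v).map fun r ↦ ι₂.symm (ι r), fun ρ₂ ↦ ?_⟩
  rw [companionClause_eventually_iff ι ι₂ ρ₂ (fun w ↦ w.residueCard) hA]
  exact Filter.eventually_congr (Filter.Eventually.of_forall fun w ↦ by rw [frobDatumPoly_eq_frobPoly_one])

end Summit.Langlands.Langlands.Theorems.LevelOneDyadic.Quadratic
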